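import Summits.QuantumFields.YangMills.Theorems.TemperedCurvatureMoments.Negative.TieLoadBearing
import Summits.QuantumFields.YangMills.Theorems.IsotropyFromPowerCountingTemperedCurvatureMomentsOfBddRenormalisation

/-!
# `TemperedCurvatureMoments` (T, stmt-QuantumFields-17721) — negative side III: the SEAM obstruction for the
# untruncated true-density witness (tightness of the intended witness against the box weight)

Disprover (cdisprove) support file for the item `IsotropyFromPowerCounting.TemperedCurvatureMoments` (T).

T asks for lattice densities `D_k` bounded on the box `[-L_k, L_k]⁴ⁿ` by the weight
`w_k(x) = C (1 + ‖a_k x‖)^N (1 + Σ_{i≠j} ‖a_k xᵢ − a_k xⱼ‖⁻¹)^N`, which is singular only at the PHYSICAL diagonal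
`a_k xᵢ = a_k xⱼ`.  The intended witness (item text; landed `temperedCurvatureMoments_of_trueDensity_tempered`,
p140303) is the TRUE renormalised density `c_kⁿ W_k`, `W_k = torusMoment …` — the centred moments of Wilson's
measure on the torus of side `2L_k+1` read through the periodic lift.  This file certifies a mismatch between the
two:

* `configShift_neg_add_period`, `torusMoment_update_period` — the true density is `(2L+1)`-PERIODIC in every site
  (the smeared field reads `torusLift`), for every `ρ, β, L`, every observable and every counterterm;
* `seam_bound` — a degree-two density that is `(2L+1)`-periodic in the second site (one instance suffices) and
  obeys T's bound on the box with constants `(C, N)` at spacing `a`, `a L ≥ 1`, is bounded by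
  `C (1 + a L)^N 2^N` at the NEAREST-NEIGHBOUR pair `(L e₀, (L+1) e₀)` of `ℤ⁴`: its periodic image
  `(L e₀, −L e₀)` lies in the box at physical separation `2 a L`, where the weight has no access to the
  `‖·‖⁻¹`-singularity;
* `trueDensity_seam_bound` — the two combined for `D = cⁿ · torusMoment ρ β L O m` (any `ρ, β, L ≥ 1, O, m, c`).

Consequence (not certifiable today — no inhabitant of the physical regime is constructed — but a statement about
the regime every prover targets): by translation invariance of Wilson's torus measure the left side is the
nearest-neighbour renormalised moment `c_k² W_k(0, e₀)`, of physical size `≍ a_k⁻⁸` for `tr F²` (`c_k ≍ a_k⁻⁴`,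
lattice correlation `O(1)` at distance one); so the untruncated true density can satisfy T's bound k-uniformly
only if `(a_k L_k)^N ≳ a_k⁻⁸`, which fails for every admissible scheme with `a_k L_k → ∞` slower than every power
of `a_k⁻¹`.  T's `∃ D` must therefore be witnessed by the true density CUT OFF near the seam — e.g. outside the
inner half-box `box 4 (L_k/2)`, where torus and box distances agree — exactly the design of `MesoTempered` /
`stub_temperedOfMeso` in line `Sketch`; a stub bounding `c_kⁿ W_k` by the box weight on the WHOLE box would be
false in the regime of interest.

References: K. Osterwalder, E. Seiler, Ann. Phys. 110 (1978) §2 (periodic Wilson measure); J. Glimm, A. Jaffe,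
Quantum Physics (1987) §9.5 (lattice approximation, periodic boundary conditions).
-/

noncomputable section

-- Mathlib's `SimplexCategory` instance `Fintype (Fin (x.len + 1))` matches `Fintype (Fin 4)` (tree-known
-- workaround, cf. the imported support files).
attribute [-instance] SimplexCategory.instFintypeToTypeOrderHomFinHAddNatLenOfNat

namespace Summit.QuantumFields.YangMills.Theorems.TemperedCurvatureMoments.Negative

open scoped BigOperators
open MeasureTheory Filter Topology
open Literature.MathematicalPhysics.QuantumLattice Literature.MathematicalPhysics.AQFT
  Literature.MathematicalPhysics.QuantumFieldTheory
open Literature.Probability.LatticeModels (box Site Torus.proj mem_box)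
open Summit.QuantumFields.YangMills.Theorems.OSLegsFromFemtoAndGap (torusMoment)

/-! ## The true density is periodic -/

section Periodic

variable {G : Type} [MeasurableSpace G]

/-- **Translating the periodic lift by a period does nothing**: `θ_{-(y + S v)} Ũ = θ_{-y} Ũ`. [folklore] -/
theorem configShift_neg_add_period (S : ℕ) (y v : Site 4) (U : GaugeConfig 4 S G) :
    configShift (-(y + (S : ℤ) • v)) (torusLift S U) = configShift (-y) (torusLift S U) := by
  funext e
  rw [configShift_apply, configShift_apply]
  show U (Torus.proj S (e.1 - -(y + (S : ℤ) • v)), e.2) = U (Torus.proj S (e.1 - -y), e.2)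
  congr 2
  funext i
  simp only [Torus.proj, Pi.sub_apply, Pi.neg_apply, Pi.add_apply, Pi.smul_apply, smul_eq_mul,
    sub_neg_eq_add, Int.cast_add, Int.cast_mul, Int.cast_natCast, ZMod.natCast_self, zero_mul, add_zero]

variable [Group G] [TopologicalSpace G] [IsTopologicalGroup G] [CompactSpace G] [BorelSpace G]

/-- **The true density is `(2L+1)`-periodic in every site**: shifting one site of the multi-site `x` by a period
vector `(2L+1) • v` does not change `torusMoment ρ β L O m x`. [folklore] -/
theorem torusMoment_update_period {M : ℕ} (ρ : G →* Matrix (Fin M) (Fin M) ℂ) (β : ℝ) (L : ℕ)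
    (O : LGConfig 4 G → ℝ) (m : ℝ) {n : ℕ} (x : Fin n → Site 4) (i : Fin n) (v : Site 4) :
    torusMoment ρ β L O m (Function.update x i (x i + ((2 * L + 1 : ℕ) : ℤ) • v)) = torusMoment ρ β L O m x := by
  unfold torusMoment
  congr 1
  funext U
  refine Finset.prod_congr rfl fun j _ => ?_
  by_cases h : j = i
  · subst h
    simp only [Function.update_self]
    rw [configShift_neg_add_period]
  · simp only [Function.update_of_ne h]

end Periodic

/-! ## The seam bound -/

/-- `siteToE` of an integer multiple of a basis vector. -/
theorem siteToE_zsmul_single (c : ℤ) (i : Fin 4) :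
    siteToE ((c • Pi.single i (1 : ℤ) : Site 4)) = (c : ℝ) • EuclideanSpace.single i (1 : ℝ) := by
  ext j
  rw [siteToE_apply]
  by_cases h : j = i
  · subst h; simp
  · simp [h]

/-- Norm of `a • siteToE (c • eᵢ)`. -/
theorem norm_smul_siteToE_zsmul_single (a : ℝ) (c : ℤ) (i : Fin 4) :
    ‖a • siteToE ((c • Pi.single i (1 : ℤ) : Site 4))‖ = |a| * |(c : ℝ)| := by
  have hs : ‖(EuclideanSpace.single i (1 : ℝ) : EuclideanSpace ℝ (Fin 4))‖ = 1 := by simp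
  rw [siteToE_zsmul_single, norm_smul, norm_smul, hs, mul_one, Real.norm_eq_abs, Real.norm_eq_abs]

/-- **Seam bound (degree two).**  Let `D : (ℤ⁴)² → ℝ` obey T's tempered bound on the box `[-L, L]⁴` with
constants `(C, N)` at spacing `a`, `a L ≥ 1`, `L ≥ 1`, and take the same value at the nearest-neighbour pair
`(L e₀, (L+1) e₀)` as at its periodic image `(L e₀, −L e₀)`.  Then `|D (L e₀, (L+1) e₀)| ≤ C (1 + a L)^N 2^N`. -/
theorem seam_bound {C a : ℝ} {N L : ℕ} (hC : 0 ≤ C) (ha : 0 < a) (hL : 1 ≤ L) (haL : 1 ≤ a * L)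
    (D : (Fin 2 → Site 4) → ℝ)
    (hper : D ![((L : ℤ) • Pi.single 0 1 : Site 4), (((L : ℤ) + 1) • Pi.single 0 1 : Site 4)] =
      D ![((L : ℤ) • Pi.single 0 1 : Site 4), ((-(L : ℤ)) • Pi.single 0 1 : Site 4)])
    (hD : ∀ x : Fin 2 → Site 4, (∀ i, x i ∈ box 4 L) → Function.Injective x →
      |D x| ≤ C * (1 + ‖fun i => a • siteToE (x i)‖) ^ N *
        (1 + ∑ i, ∑ j ∈ Finset.univ.erase i, ‖a • siteToE (x i) - a • siteToE (x j)‖⁻¹) ^ N) :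
    |D ![((L : ℤ) • Pi.single 0 1 : Site 4), (((L : ℤ) + 1) • Pi.single 0 1 : Site 4)]| ≤
      C * (1 + a * L) ^ N * 2 ^ N := by
  rw [hper]
  set x : Fin 2 → Site 4 := ![((L : ℤ) • Pi.single 0 1 : Site 4), ((-(L : ℤ)) • Pi.single 0 1 : Site 4)]
    with hx
  have hx0 : x 0 = (L : ℤ) • Pi.single 0 1 := rfl
  have hx1 : x 1 = (-(L : ℤ)) • Pi.single 0 1 := rfl
  have hbox : ∀ i, x i ∈ box 4 L := by
    intro i
    fin_cases i
    · show ((L : ℤ) • Pi.single 0 1 : Site 4) ∈ box 4 L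
      rw [mem_box]; intro j
      by_cases hj : j = 0
      · subst hj; simp
      · simp [Pi.single_eq_of_ne hj]
    · show ((-(L : ℤ)) • Pi.single 0 1 : Site 4) ∈ box 4 L
      rw [mem_box]; intro j
      by_cases hj : j = 0
      · subst hj; simp
      · simp [Pi.single_eq_of_ne hj]
  have hinj : Function.Injective x := by
    intro i j hij
    fin_cases i <;> fin_cases j
    · rfl
    · exfalso
      have h := congrFun hij 0
      simp [hx0, hx1] at h
      omega
    · exfalso
      have h := congrFun hij 0
      simp [hx0, hx1] at h
      omega
    · rfl
  have hbd := hD x hbox hinj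
  have hnorm : ‖fun i => a • siteToE (x i)‖ ≤ a * L := by
    refine (pi_norm_le_iff_of_nonneg (by positivity)).2 fun i => ?_
    fin_cases i
    · show ‖a • siteToE (x 0)‖ ≤ a * L
      rw [hx0, norm_smul_siteToE_zsmul_single, abs_of_pos ha]
      simp
    · show ‖a • siteToE (x 1)‖ ≤ a * L
      rw [hx1, norm_smul_siteToE_zsmul_single, abs_of_pos ha]
      simp
  have hdiff : ‖a • siteToE (x 0) - a • siteToE (x 1)‖ = 2 * (a * L) := by
    have hs : ‖(EuclideanSpace.single (0 : Fin 4) (1 : ℝ) : EuclideanSpace ℝ (Fin 4))‖ = 1 := by simp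
    have h2L : (((L : ℤ) : ℝ) - ((-(L : ℤ) : ℤ) : ℝ)) = 2 * (L : ℝ) := by push_cast; ring
    rw [hx0, hx1, ← smul_sub, siteToE_zsmul_single, siteToE_zsmul_single, ← sub_smul, norm_smul, norm_smul,
      hs, mul_one, Real.norm_eq_abs, Real.norm_eq_abs, abs_of_pos ha, h2L,
      abs_of_nonneg (by positivity : (0 : ℝ) ≤ 2 * (L : ℝ))]
    ring
  have hdiff' : ‖a • siteToE (x 1) - a • siteToE (x 0)‖ = 2 * (a * L) := by
    rw [norm_sub_rev, hdiff]
  have hsum : ∑ i, ∑ j ∈ Finset.univ.erase i, ‖a • siteToE (x i) - a • siteToE (x j)‖⁻¹ = (a * L)⁻¹ := by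
    rw [Fin.sum_univ_two]
    have h0 : (Finset.univ : Finset (Fin 2)).erase 0 = {1} := by decide
    have h1 : (Finset.univ : Finset (Fin 2)).erase 1 = {0} := by decide
    rw [h0, h1, Finset.sum_singleton, Finset.sum_singleton, hdiff, hdiff']
    field_simp
    norm_num
  have hsum_le : (1 + ∑ i, ∑ j ∈ Finset.univ.erase i, ‖a • siteToE (x i) - a • siteToE (x j)‖⁻¹) ≤ 2 := by
    rw [hsum]
    have : (a * L)⁻¹ ≤ 1 := inv_le_one_of_one_le₀ haL
    linarith
  calc |D x| ≤ C * (1 + ‖fun i => a • siteToE (x i)‖) ^ N *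
        (1 + ∑ i, ∑ j ∈ Finset.univ.erase i, ‖a • siteToE (x i) - a • siteToE (x j)‖⁻¹) ^ N := hbd
    _ ≤ C * (1 + a * L) ^ N * 2 ^ N := by
        have hS0 : 0 ≤ ∑ i, ∑ j ∈ Finset.univ.erase i, ‖a • siteToE (x i) - a • siteToE (x j)‖⁻¹ :=
          Finset.sum_nonneg fun i _ => Finset.sum_nonneg fun j _ => inv_nonneg.2 (norm_nonneg _)
        have h1 : (1 + ‖fun i => a • siteToE (x i)‖) ^ N ≤ (1 + a * L) ^ N :=
          pow_le_pow_left₀ (by positivity) (by linarith [hnorm]) N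
        have h2 : (1 + ∑ i, ∑ j ∈ Finset.univ.erase i, ‖a • siteToE (x i) - a • siteToE (x j)‖⁻¹) ^ N ≤
            2 ^ N := pow_le_pow_left₀ (by linarith) hsum_le N
        exact mul_le_mul (mul_le_mul_of_nonneg_left h1 hC) h2 (pow_nonneg (by linarith) N)
          (mul_nonneg hC (pow_nonneg (by positivity) N))

/-! ## The seam bound for the true density -/

section TrueDensity

variable {G : Type} [Group G] [TopologicalSpace G] [IsTopologicalGroup G] [CompactSpace G]
  [MeasurableSpace G] [BorelSpace G]

/-- The nearest-neighbour pair across the seam is the periodic image of an antipodal pair of the box: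
`update (L e₀, (L+1) e₀) 1 ((L+1) e₀ + (2L+1) • (−e₀)) = (L e₀, −L e₀)`. -/
theorem seam_pair_update (L : ℕ) :
    Function.update (![((L : ℤ) • Pi.single 0 1 : Site 4), (((L : ℤ) + 1) • Pi.single 0 1 : Site 4)] :
        Fin 2 → Site 4) 1
      ((![((L : ℤ) • Pi.single 0 1 : Site 4), (((L : ℤ) + 1) • Pi.single 0 1 : Site 4)] : Fin 2 → Site 4) 1 +
        ((2 * L + 1 : ℕ) : ℤ) • (-(Pi.single 0 1) : Site 4)) =
      ![((L : ℤ) • Pi.single 0 1 : Site 4), ((-(L : ℤ)) • Pi.single 0 1 : Site 4)] := by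
  funext i
  fin_cases i
  · rfl
  · show (((L : ℤ) + 1) • Pi.single 0 1 : Site 4) + ((2 * L + 1 : ℕ) : ℤ) • (-(Pi.single 0 1) : Site 4) =
      ((-(L : ℤ)) • Pi.single 0 1 : Site 4)
    rw [smul_neg, ← neg_smul, ← add_smul]
    congr 1
    push_cast
    ring

/-- **Seam bound for the TRUE density (degree two).**  For every `ρ, β`, `L ≥ 1`, observable `O`, counterterm
`m` and multiplicative renormalisation `c`, at spacing `a` with `a L ≥ 1`: IF the true renormalised density
`D x = c² · torusMoment ρ β L O m x` obeys T's tempered bound on the box with constants `(C, N)`, THEN its value at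
the nearest-neighbour pair `(L e₀, (L+1) e₀)` is at most `C (1 + a L)^N 2^N`.  (Periodicity supplies the
hypothesis `hper` of `seam_bound`.)  Read contrapositively along a scheme: a nearest-neighbour renormalised moment
growing faster than every power of `a_k L_k` — the physical regime whenever `a_k L_k` is sub-polynomial in
`a_k⁻¹` — forbids the untruncated true density as T's witness. -/
theorem trueDensity_seam_bound {M : ℕ} (ρ : G →* Matrix (Fin M) (Fin M) ℂ) (β : ℝ) {L : ℕ}
    (O : LGConfig 4 G → ℝ) (m c : ℝ) {C a : ℝ} {N : ℕ} (hC : 0 ≤ C) (ha : 0 < a) (hL : 1 ≤ L)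
    (haL : 1 ≤ a * L)
    (hD : ∀ x : Fin 2 → Site 4, (∀ i, x i ∈ box 4 L) → Function.Injective x →
      |c ^ 2 * torusMoment ρ β L O m x| ≤ C * (1 + ‖fun i => a • siteToE (x i)‖) ^ N *
        (1 + ∑ i, ∑ j ∈ Finset.univ.erase i, ‖a • siteToE (x i) - a • siteToE (x j)‖⁻¹) ^ N) :
    |c ^ 2 * torusMoment ρ β L O m
        ![((L : ℤ) • Pi.single 0 1 : Site 4), (((L : ℤ) + 1) • Pi.single 0 1 : Site 4)]| ≤
      C * (1 + a * L) ^ N * 2 ^ N := by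
  refine seam_bound hC ha hL haL (fun x => c ^ 2 * torusMoment ρ β L O m x) ?_ hD
  show c ^ 2 * torusMoment ρ β L O m _ = c ^ 2 * torusMoment ρ β L O m _
  rw [← seam_pair_update L, torusMoment_update_period]

end TrueDensity

end Summit.QuantumFields.YangMills.Theorems.TemperedCurvatureMoments.Negative

end
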